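import Summits.HubbardSuperconductivity.HubbardSuperconductivity.Theorems.KLProgrammeKLRegimeFlowReadScaleZeroSunsetCertRows
import Summits.HubbardSuperconductivity.HubbardSuperconductivity.Theorems.KLProgrammeKLRegimeFlowReadScaleZeroSunsetFarRows

/-!
# Route `KLProgramme`, crux K3 — engine-flow child (stmt-HubbardSuperconductivity-20437), stub (C) at `n = 0`, located item #22a «(C)-SCALE0-PT2»:
# THE CERTIFIED SUNSET ROWS FROM THE TWO CERTIFICATES — near disk (`ScaleZeroSunsetCertV3`) + far jets (`ScaleZeroFarJetCert`)

Seat hubbard-kl-k3c5-p1 (g14; owner of #22a).  One application of `sunsetRows_of_certV3` (`…SunsetCertRows`) with its far-site input `hfar` DISCHARGED by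
`farRows_le_of_jets` (`…SunsetFarRows`): **`sunsetRows_of_certs`** — the hypotheses `hS0` and `hSk` (k = 1, 2) of `twoLegRead_frameZero_of_sunsetData`,
literally, from the μ-cell record `c` (`ScaleZeroSunsetCertV3 c`: profiles + Tmax-augmented octave table on the disk `0 < ‖z‖∞ ≤ Rc`) and the far record
`cf` (`ScaleZeroFarJetCert cf`: one momentum-jet envelope, order `n`, constant `Jn`), for `μ` in both cells and in `klWindowC`, `klBetaMin ≤ β`,
`L ≥ klEngL₃ β U`, `β/4M ≤ 2⁻¹⁰`, torus-tail parameters (`N′ ≥ 4`, `R + 1 + 2Rc ≤ L`), the ONE tail-smallness hypothesis, `0 ≤ row k`, and every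
`bS k ≥ row k + 16·2ᵏ·9·(Jn²/(klE0/2)³)·((1+4ⁿSₙ)/πⁿ)²·(Rc+2)^{−(2n−4−k)}`.  No far-site input remains; the two certificate predicates are the only
undischarged hypotheses (KIT JOB A, D-0022 lane).

No definitions; nothing here asserts (C), any stub of 20437, K3 or superconductivity.
References: BGM 2006 §2.3 (2.17)–(2.20), (2.80), §3 (3.2) [cite: BenfattoGiulianiMastropietro2006].
-/

noncomputable section

namespace Summit.HubbardSuperconductivity.HubbardSuperconductivity.Theorems.KLRegimeSplit

set_option linter.dupNamespace false -- summit = problem name (single-conjunct summit), D-0017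

open Literature.MathematicalPhysics.QuantumLattice Literature.Probability.LatticeModels Literature.Analysis.FunctionSpaces
open Summit.HubbardSuperconductivity.HubbardSuperconductivity.Theorems.DispersionFlow
open Summit.HubbardSuperconductivity.HubbardSuperconductivity.Theorems.EngineV8
open MeasureTheory Set Finset Complex UnitAddTorus Real GrassmannAlgebra Matrix
open scoped FourierTransform Nat ENNReal NNReal

variable {L M : ℕ} [NeZero L]

/-- **THE CERTIFIED SUNSET ROWS `hS0` / `hSk` OF THE ASSEMBLY FROM THE TWO CERTIFICATES** (near: `ScaleZeroSunsetCertV3 c`; far: `ScaleZeroFarJetCert cf`). -/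
theorem sunsetRows_of_certs [NeZero M] (c : SunsetCellRecordV3) (hc : ScaleZeroSunsetCertV3 c) (cf : SunsetFarRecord) (hcf : ScaleZeroFarJetCert cf)
    {μ U β : ℝ} (hμ : μ ∈ klWindowC) (hμlo : (c.μlo : ℝ) ≤ μ) (hμhi : μ ≤ c.μhi) (hμlo' : (cf.μlo : ℝ) ≤ μ) (hμhi' : μ ≤ cf.μhi)
    (hβ : klBetaMin ≤ β) (hL : klEngL₃ β U ≤ L) (hδ : β / ((2 * (2 * M) : ℕ) : ℝ) ≤ (2 : ℝ)⁻¹ ^ 10)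
    {N' R : ℕ} (hN' : 2 * 2 ≤ N') (hR : R + 1 + 2 * c.Rc ≤ L)
    (hT : ENNReal.ofReal (β / klBetaMin) *
        ENNReal.ofReal ((19 / 3) * (4 + |μ| + (0 : TrigPolyC4v).coeffNorm 0) * β / (2 * π ^ 2 * M) +
            (N' ! * klChi2CauchyTab N' * (N' + 1) ! * 4 * (max 1 (4 / klE0)) ^ (N' - 1) * ((2 * π) * 4) ^ N') * (2 / klE0) *
              (1 / (2 * Real.pi) ^ N' * (2 / ((2 * R + 2 : ℕ) : ℝ)) ^ (N' - 2 * 2) * (2 ^ 2 * ∑' k : Site 2, ∏ j, (1 + (k j : ℝ) ^ 2)⁻¹))) ≤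
      ENNReal.ofReal (c.Tmax : ℝ))
    (hrow : ∀ k : Fin 3, 0 ≤ (c.row k : ℝ)) {bS : ℕ → ℝ}
    (hbS : ∀ k : Fin 3, (c.row k : ℝ) +
      16 * 2 ^ (k : ℕ) * 9 * (((cf.Jn : ℝ) ^ 2 / (klE0 / 2) ^ 3) * ((1 + (4 : ℝ) ^ cf.n * ∑' q : Site 2, ((1 + ‖q‖) ^ cf.n)⁻¹) / Real.pi ^ cf.n) ^ 2) *
          (((c.Rc : ℝ) + 2) ^ (2 * cf.n - 4 - (k : ℕ)))⁻¹ ≤ bS k) :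
    (∀ (σ : Fin 2) (p₀ : GridPoint L (2 * (2 * M))), ∑ p₁ : GridPoint L (2 * (2 * M)),
      (if p₁ = p₀ then (0 : ℝ) else (if p₁.2 - p₀.2 = 0 then (0 : ℝ) else 1) * ‖contr ℂ ((hubbardGridSub L M β (2 * (2 * M))).transpose * hubbardCovAboveCT L M β μ 0 0 klE0 *
                hubbardGridSub L M β (2 * (2 * M))) (((p₁, σ), 0) : GridLeg (GridPoint L (2 * (2 * M)))) ((p₀, σ), 1) *
              (contr ℂ ((hubbardGridSub L M β (2 * (2 * M))).transpose * hubbardCovAboveCT L M β μ 0 0 klE0 *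
                hubbardGridSub L M β (2 * (2 * M))) (((p₀, σ.rev), 0) : GridLeg (GridPoint L (2 * (2 * M)))) ((p₁, σ.rev), 1) *
                contr ℂ ((hubbardGridSub L M β (2 * (2 * M))).transpose * hubbardCovAboveCT L M β μ 0 0 klE0 *
                hubbardGridSub L M β (2 * (2 * M))) (((p₁, σ.rev), 0) : GridLeg (GridPoint L (2 * (2 * M)))) ((p₀, σ.rev), 1))‖) ≤ bS 0 * (((2 * (2 * M) : ℕ) : ℝ) / β)) ∧
    (∀ k, 1 ≤ k → k ≤ 2 → ∀ (σ : Fin 2) (p₀ : GridPoint L (2 * (2 * M))), ∑ p₁ : GridPoint L (2 * (2 * M)),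
      (if p₁ = p₀ then (0 : ℝ) else
        Real.sqrt ((((p₁.2 - p₀.2) 0).valMinAbs.natAbs : ℝ) ^ 2 + (((p₁.2 - p₀.2) 1).valMinAbs.natAbs : ℝ) ^ 2) ^ k * ‖contr ℂ ((hubbardGridSub L M β (2 * (2 * M))).transpose * hubbardCovAboveCT L M β μ 0 0 klE0 *
                hubbardGridSub L M β (2 * (2 * M))) (((p₁, σ), 0) : GridLeg (GridPoint L (2 * (2 * M)))) ((p₀, σ), 1) *
              (contr ℂ ((hubbardGridSub L M β (2 * (2 * M))).transpose * hubbardCovAboveCT L M β μ 0 0 klE0 *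
                hubbardGridSub L M β (2 * (2 * M))) (((p₀, σ.rev), 0) : GridLeg (GridPoint L (2 * (2 * M)))) ((p₁, σ.rev), 1) *
                contr ℂ ((hubbardGridSub L M β (2 * (2 * M))).transpose * hubbardCovAboveCT L M β μ 0 0 klE0 *
                hubbardGridSub L M β (2 * (2 * M))) (((p₁, σ.rev), 0) : GridLeg (GridPoint L (2 * (2 * M)))) ((p₀, σ.rev), 1))‖) ≤
        bS k * (((2 * (2 * M) : ℕ) : ℝ) / β)) :=
  sunsetRows_of_certV3 c hc hμlo hμhi hβ hδ hN' hR hT hrow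
    (bFar := fun k => 16 * 2 ^ k * 9 * (((cf.Jn : ℝ) ^ 2 / (klE0 / 2) ^ 3) *
      ((1 + (4 : ℝ) ^ cf.n * ∑' q : Site 2, ((1 + ‖q‖) ^ cf.n)⁻¹) / Real.pi ^ cf.n) ^ 2) * (((c.Rc : ℝ) + 2) ^ (2 * cf.n - 4 - k))⁻¹)
    (fun k σ p₀ => farRows_le_of_jets c.toSunsetCellRecordV2 hμ hβ hL hcf.1 (hcf.2 μ hμlo' hμhi') k σ p₀) hbS

end Summit.HubbardSuperconductivity.HubbardSuperconductivity.Theorems.KLRegimeSplit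

end
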